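import Summits.ABC.ABC.Theses.RootDecompJ
import HarnessLib

/-!
# Route RootDecompJ — `Assembly` (item stmt-ABC-29356)

`CampanaHyperbolicBound → EuclideanABC → SphericalABC → ABC` (`Summit.ABC.ABC.Theses.RootDecompJ.Assembly`), proved unconditionally: the route's
root pieces are its hypotheses, nothing else is assumed.  Trichotomy on the powerfulness profile (p,q,r): hyperbolic triples are bounded (c ≤ B < (B+1)·rad^(1+ε)), euclidean and spherical ones are abc by hypothesis; C := max (B+1) (max C₁ C₂).

The proof is the body of the route's deciding theorem `RootDecompJ.closes` copied VERBATIM rather than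
a citation of `closes`, so that this file keeps compiling under any later re-glue of the route
(cell decomp-abc, writer LANDING LIST; D-0178 root decomposition, door J).  Bookkeeping only: nothing
here proves `ABC` or decides the route's declared residual.
-/

set_option linter.dupNamespace false

namespace Summit.ABC.ABC.Theorems

/-- Item stmt-ABC-29356, literally the route decl `RootDecompJ.Assembly` (`CampanaHyperbolicBound → EuclideanABC → SphericalABC → ABC`). -/
theorem rootDecompJ_assembly_proof : Summit.ABC.ABC.Theses.RootDecompJ.Assembly := by
  unfold Summit.ABC.ABC.Theses.RootDecompJ.Assembly
  intro h₁ h₂ h₃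
  rw [_root_.ABC_iff]
  intro ε hε
  obtain ⟨B, hB⟩ := h₁
  obtain ⟨C₁, hC₁, hE⟩ := h₂ ε hε
  obtain ⟨C₂, hC₂, hS⟩ := h₃ ε hε
  refine ⟨max ((B : ℝ) + 1) (max C₁ C₂), lt_max_of_lt_left (by positivity), fun a b c ht => ?_⟩
  have hrad : 0 < Literature.NumberTheory.DiophantineGeometry.rad a b c := by
    rw [Literature.NumberTheory.DiophantineGeometry.rad_def]; exact Nat.radical_pos _
  have hR1 : (1 : ℝ) ≤ ((Literature.NumberTheory.DiophantineGeometry.rad a b c : ℕ) : ℝ) ^ (1 + ε) :=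
    Real.one_le_rpow (by exact_mod_cast hrad) (by linarith)
  have hR0 : (0 : ℝ) < ((Literature.NumberTheory.DiophantineGeometry.rad a b c : ℕ) : ℝ) ^ (1 + ε) := by
    linarith
  by_cases hH : ∃ p q r : ℕ, ((p = 0 → a = 1) ∧ ∀ ℓ ∈ a.primeFactors, p ≤ a.factorization ℓ) ∧
      ((q = 0 → b = 1) ∧ ∀ ℓ ∈ b.primeFactors, q ≤ b.factorization ℓ) ∧
      ((r = 0 → c = 1) ∧ ∀ ℓ ∈ c.primeFactors, r ≤ c.factorization ℓ) ∧
      (p : ℚ)⁻¹ + (q : ℚ)⁻¹ + (r : ℚ)⁻¹ < 1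
  · have hc : (c : ℝ) ≤ B := by exact_mod_cast hB a b c ht hH
    calc (c : ℝ) < (B : ℝ) + 1 := by linarith
      _ ≤ ((B : ℝ) + 1) * ((Literature.NumberTheory.DiophantineGeometry.rad a b c : ℕ) : ℝ) ^ (1 + ε) :=
          le_mul_of_one_le_right (by positivity) hR1
      _ ≤ _ := mul_le_mul_of_nonneg_right (le_max_left _ _) hR0.le
  by_cases hEu : ∃ p q r : ℕ, ((p = 0 → a = 1) ∧ ∀ ℓ ∈ a.primeFactors, p ≤ a.factorization ℓ) ∧
      ((q = 0 → b = 1) ∧ ∀ ℓ ∈ b.primeFactors, q ≤ b.factorization ℓ) ∧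
      ((r = 0 → c = 1) ∧ ∀ ℓ ∈ c.primeFactors, r ≤ c.factorization ℓ) ∧
      (p : ℚ)⁻¹ + (q : ℚ)⁻¹ + (r : ℚ)⁻¹ = 1
  · exact (hE a b c ht hEu).trans_le
      (mul_le_mul_of_nonneg_right ((le_max_left _ _).trans (le_max_right _ _)) hR0.le)
  have hSp : ∀ p q r : ℕ, ((p = 0 → a = 1) ∧ ∀ ℓ ∈ a.primeFactors, p ≤ a.factorization ℓ) →
      ((q = 0 → b = 1) ∧ ∀ ℓ ∈ b.primeFactors, q ≤ b.factorization ℓ) →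
      ((r = 0 → c = 1) ∧ ∀ ℓ ∈ c.primeFactors, r ≤ c.factorization ℓ) →
      1 < (p : ℚ)⁻¹ + (q : ℚ)⁻¹ + (r : ℚ)⁻¹ := by
    intro p q r hp hq hr
    rcases lt_trichotomy ((p : ℚ)⁻¹ + (q : ℚ)⁻¹ + (r : ℚ)⁻¹) 1 with h | h | h
    · exact absurd ⟨p, q, r, hp, hq, hr, h⟩ hH
    · exact absurd ⟨p, q, r, hp, hq, hr, h⟩ hEu
    · exact h
  exact (hS a b c ht hSp).trans_le
    (mul_le_mul_of_nonneg_right ((le_max_right _ _).trans (le_max_right _ _)) hR0.le)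

end Summit.ABC.ABC.Theorems
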